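import Mathlib
import HarnessLib
import Summits.NavierStokesRegularity.FluidComputer.PalasekTowerRescaledCopyHeredity

/-!
# Line `fc-oneshot`: the copy tolerance as a parameter — `CaptureAtδ`, `Captureδ`, `Renormaliseδ`,
# propagation at general tolerance, and the tolerance at which the copy clause is automatic

Cell `ns-blowup`, seat `ns-blowup-fc-prover-2` (g4; D-0074 GROUP C «bridge support»). Companion of
`PalasekTowerRescaledCopy.lean` (p422042: the relation `RescaledCopy S j k w v δ` and the line's open
statements `Capture` / `CaptureAt k` / `Renormalise`, all at the registered tolerance `δ = 2/3`) and of
`PalasekTowerRescaledCopyHeredity.lean` (p422280 / p424480: `CaptureAt.succ`, `capture_iff_captureAt_two`,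
`heredityFrom_two_of_capture_renormalise`, …). LABEL: E–C typing / bookkeeping. WHAT THIS IS NOT: not
Navier–Stokes evidence — three OPEN statements of the parked crux line `fc-oneshot` (item
stmt-NavierStokesRegularity-19178) with the copy tolerance made a PARAMETER, never asserted, and
implications between them; no stage, letter, tower or instance is constructed or claimed; the COPY-FIT
words of the cell (MODEL surrogates, `e ≈ 0.37–0.50`, «re-type δ ≤ 1/3») are MODEL readings and never enter.

## Why

The line owner records (`ns-blowup` STATUS 2026-08-26 l.3017, file `lines/fc-oneshot.v24-third.OPTION.lean`):
the registered stubs are `stub_captureAtTwo : CaptureAt 2` and `stub_renormalise : Renormalise`, both at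
tolerance `2/3`; a line-local `CaptureAtδ 2 (1/3)` composes with the `2/3` gate through
`RescaledCopy.mono`, but «a δ-UNIFORM gate re-typing needs `CaptureAtδ.succ` at general δ — prover work,
not typed». This module supplies it, by name, in the tree:

* §1 `CaptureAtδ k δ`, `Captureδ δ`, `Renormaliseδ δin δout` (the tree's `CaptureAt k`, `Capture`,
  `Renormalise` are the instances `δ = δin = δout = 2/3` ON THE NOSE: `captureAtδ_two_thirds_iff`,
  `captureδ_two_thirds_iff`, `renormaliseδ_two_thirds_iff`, all `Iff.rfl`); monotonicity in the
  tolerances (`CaptureAtδ.mono`, `Captureδ.mono`, `Renormaliseδ.mono` — antitone in the input tolerance,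
  monotone in the output tolerance); `captureδ_iff_forall_captureAtδ`.
* §2 Propagation at general tolerance: `CaptureAtδ.succ : CaptureAtδ k δ → Renormaliseδ δ δ' → 2 ≤ k →
  CaptureAtδ (k+1) δ'` (restriction of the stage, the gate, silent-window uniqueness
  `Stage.continuation_velocity_eq` — no named fact), `CaptureAtδ.of_le`, `captureδ_iff_captureAtδ_two`
  (given a gate `Renormaliseδ δ δ` that PRESERVES the tolerance, alphabet closure at tolerance `δ` is a
  statement about level-`2` stages only), `heredityFrom_two_of_captureδ_renormaliseδ`,
  `Renormaliseδ.of_heredityFrom_two`, `renormaliseδ_iff_heredityFrom_two`, and the two compositions a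
  δ-uniform re-registration of the line would use:
  `episodeInductionG_of_heredityAtOne_captureAtδ_two_renormaliseδ : HeredityAtOne → CaptureAtδ 2 δ →
  Renormaliseδ δ δ → EpisodeInductionG` and (gate kept at `2/3`, capture tightened to any `δ ≤ 2/3`)
  `episodeInductionG_of_heredityAtOne_captureAtδ_two_renormalise`.
* §3 Where the copy clause is AUTOMATIC: for every stage (any margin), every `j ≤ k` and every tolerance
  `δ ≥ 2 c₂`, the level-`k` readout is a `δ`-copy of the level-`j` readout
  (`Stage.rescaledCopy_of_two_mul_c₂_le`: anchor and centre at the level-`k` floor point, `Q = 1`, the two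
  ceilings `‖u(τ k)‖ ≤ c₂ Y_k`, `‖u(τ j)‖ ≤ c₂ Y_j` and the triangle inequality) — so `CaptureAtδ` has
  content on a schedule exactly for `δ < 2 c₂`, and (by `RescaledCopy.parent_floor`, p422042) it forces
  an ACTIVE parent patch exactly for `δ < c₁`.

References: T. Tao, J. Amer. Math. Soc. 29 (2016) 601–674, §1.3 (robust gates, self-similar alphabet)
[cite: Tao2016AveragedNS, §1.3]; S. Palasek, arXiv:2605.13827 §3.3–§4 [cite: Palasek2026ElementaryModel, §4];
T. Tao, Anal. PDE 6 (2013), Cor. 11.4 (silent-window uniqueness is the tree's unforced theorem)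
[cite: Tao2011, Cor. 11.4]. 0 sorry; axioms ⊆ {propext, Classical.choice, Quot.sound}.
-/

noncomputable section

namespace Summit.NavierStokesRegularity.FluidComputer.PalasekTowerClayBridge

open Set MeasureTheory Filter Topology Function Real
open scoped ENNReal ContDiff NNReal
open Literature.Analysis.FluidPDE

/-! ## §1 The line's statements with the copy tolerance as a parameter -/

/-- **Capture AT level `k` WITH TOLERANCE `δ`** (OPEN for every `k ≥ 2` and every `δ`; never asserted):
every registered stage at level `k` of a pinned (`Λ = 8`, `θ = 6/5`), rigid, quiet schedule on the
wide-base rates is a `δ`-rescaled copy between its letters of levels `k - 1` and `k`. The tree's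
`CaptureAt k` is `CaptureAtδ k (2/3)` (`captureAtδ_two_thirds_iff`). [cite: Tao2016AveragedNS, §1.3] -/
@[conjecture] def CaptureAtδ (k : ℕ) (δ : ℝ) : Prop :=
  ∀ S : Schedule TowerRates.wide, S.Pins 8 (6 / 5) → S.Rigid → S.Quiet →
    ∀ s : Stage 1 TowerRates.wide S (Margins.routeG TowerRates.wide) k,
      RescaledCopy S (k - 1) k (s.u (S.τ (k - 1))) (s.u (S.τ k)) δ

/-- **CAPTURE WITH TOLERANCE `δ`** — alphabet closure at every level `k ≥ 2` (OPEN; never asserted).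
The tree's `Capture` is `Captureδ (2/3)` (`captureδ_two_thirds_iff`). [cite: Tao2016AveragedNS, §1.3] -/
@[conjecture] def Captureδ (δ : ℝ) : Prop :=
  ∀ S : Schedule TowerRates.wide, S.Pins 8 (6 / 5) → S.Rigid → S.Quiet → ∀ k : ℕ, 2 ≤ k →
    ∀ s : Stage 1 TowerRates.wide S (Margins.routeG TowerRates.wide) k,
      RescaledCopy S (k - 1) k (s.u (S.τ (k - 1))) (s.u (S.τ k)) δ

/-- **RENORMALISE WITH TOLERANCES `(δin, δout)`** — the robust one-shot gate, uniformly in `k ≥ 2`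
(OPEN; never asserted): a registered level-`k` letter that is a `δin`-copy of its predecessor runs to a
continuation inside the next ceiling whose field at `τ (k+1)` is a level-`(k+1)` letter AND a
`δout`-copy of the level-`k` letter. The tree's `Renormalise` is `Renormaliseδ (2/3) (2/3)`
(`renormaliseδ_two_thirds_iff`). [cite: Tao2016AveragedNS, §1.3] -/
@[conjecture] def Renormaliseδ (δin δout : ℝ) : Prop :=
  ∀ S : Schedule TowerRates.wide, S.Pins 8 (6 / 5) → S.Rigid → S.Quiet → ∀ k : ℕ, 2 ≤ k →
    ∀ s : Stage 1 TowerRates.wide S (Margins.routeG TowerRates.wide) k,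
      RescaledCopy S (k - 1) k (s.u (S.τ (k - 1))) (s.u (S.τ k)) δin →
      ∃ (u : ℝ → EuclideanSpace ℝ (Fin 3) → EuclideanSpace ℝ (Fin 3))
        (p : ℝ → EuclideanSpace ℝ (Fin 3) → ℝ),
        Runs S k s u p ∧ Letter S (k + 1) (u (S.τ (k + 1))) ∧
        RescaledCopy S k (k + 1) (s.u (S.τ k)) (u (S.τ (k + 1))) δout

/-- The tree's `CaptureAt k` is `CaptureAtδ k (2/3)` on the nose. [folklore] -/
theorem captureAtδ_two_thirds_iff (k : ℕ) : CaptureAtδ k (2 / 3) ↔ CaptureAt k := Iff.rfl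

/-- The tree's `Capture` is `Captureδ (2/3)` on the nose. [folklore] -/
theorem captureδ_two_thirds_iff : Captureδ (2 / 3) ↔ Capture := Iff.rfl

/-- The tree's `Renormalise` is `Renormaliseδ (2/3) (2/3)` on the nose. [folklore] -/
theorem renormaliseδ_two_thirds_iff : Renormaliseδ (2 / 3) (2 / 3) ↔ Renormalise := Iff.rfl

/-- `Captureδ δ` is the conjunction of its one-level truncations. [folklore] -/
theorem captureδ_iff_forall_captureAtδ {δ : ℝ} : Captureδ δ ↔ ∀ k, 2 ≤ k → CaptureAtδ k δ :=
  ⟨fun h k hk S hP hR hQ s => h S hP hR hQ k hk s, fun h S hP hR hQ k hk s => h k hk S hP hR hQ s⟩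

/-- `Captureδ δ` contains each truncation `CaptureAtδ k δ`, `k ≥ 2`. [folklore] -/
theorem Captureδ.captureAtδ {δ : ℝ} (h : Captureδ δ) {k : ℕ} (hk : 2 ≤ k) : CaptureAtδ k δ :=
  captureδ_iff_forall_captureAtδ.1 h k hk

/-- Capture at a level is monotone in the tolerance. [folklore] -/
theorem CaptureAtδ.mono {k : ℕ} {δ δ' : ℝ} (h : CaptureAtδ k δ) (hδ : δ ≤ δ') : CaptureAtδ k δ' :=
  fun S hP hR hQ s => (h S hP hR hQ s).mono hδ

/-- Capture is monotone in the tolerance. [folklore] -/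
theorem Captureδ.mono {δ δ' : ℝ} (h : Captureδ δ) (hδ : δ ≤ δ') : Captureδ δ' :=
  fun S hP hR hQ k hk s => (h S hP hR hQ k hk s).mono hδ

/-- The gate is ANTITONE in the input tolerance and MONOTONE in the output tolerance. [folklore] -/
theorem Renormaliseδ.mono {δin δin' δout δout' : ℝ} (h : Renormaliseδ δin δout) (hin : δin' ≤ δin)
    (hout : δout ≤ δout') : Renormaliseδ δin' δout' := by
  intro S hP hR hQ k hk s hcopy
  obtain ⟨u, p, hrun, hlet, hc⟩ := h S hP hR hQ k hk s (hcopy.mono hin)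
  exact ⟨u, p, hrun, hlet, hc.mono hout⟩

/-- Tightening the capture stub: `CaptureAtδ k δ` with `δ ≤ 2/3` gives the registered `CaptureAt k`.
[folklore] -/
theorem CaptureAtδ.captureAt {k : ℕ} {δ : ℝ} (h : CaptureAtδ k δ) (hδ : δ ≤ 2 / 3) : CaptureAt k :=
  (captureAtδ_two_thirds_iff k).1 (h.mono hδ)

/-- A gate accepting `2/3`-copies and returning copies within `2/3` gives the registered `Renormalise`.
[folklore] -/
theorem Renormaliseδ.renormalise {δin δout : ℝ} (h : Renormaliseδ δin δout) (hin : 2 / 3 ≤ δin)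
    (hout : δout ≤ 2 / 3) : Renormalise :=
  renormaliseδ_two_thirds_iff.1 (h.mono hin hout)

/-! ## §2 Propagation and composition at general tolerance -/

/-- **One step of propagation at general tolerance.** Given a gate `Renormaliseδ δ δ'`, capture at
level `k ≥ 2` with tolerance `δ` implies capture at level `k + 1` with tolerance `δ'`: a registered stage
`s` at level `k + 1` restricts to level `k` (`Stage.restrictOfAntitone`), the restriction is a `δ`-copy by
`CaptureAtδ k δ`, the gate returns a finite-energy classical continuation `u` to `τ (k+1)` whose readout
is a `δ'`-copy of the level-`k` letter, and `u = s.u` on `[0, τ (k+1)]` by silent-window uniqueness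
(`Stage.continuation_velocity_eq`: quiet schedule, `k ≥ 2`; the tree's unforced theorem, no named
fact). [cite: Tao2011, Cor. 11.4] -/
theorem CaptureAtδ.succ {k : ℕ} {δ δ' : ℝ} (h : CaptureAtδ k δ) (hR : Renormaliseδ δ δ')
    (hk : 2 ≤ k) : CaptureAtδ (k + 1) δ' := by
  intro S hP hRig hQ s
  let s₀ : Stage 1 TowerRates.wide S (Margins.routeG TowerRates.wide) k :=
    s.restrictOfAntitone (Margins.antitone_routeG TowerRates.wide) (Nat.le_succ k)
  obtain ⟨u, p, ⟨hcl, hagree, henergy, -⟩, -, hcopy⟩ := hR S hP hRig hQ k hk s₀ (h S hP hRig hQ s₀)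
  have heq : ∀ t ∈ Icc 0 (S.τ (k + 1)), u t = s.u t :=
    s₀.continuation_velocity_eq one_pos hQ hk (S.τ_mono (Nat.le_succ k)) hcl s.classical
      (fun t ht => (hagree t ht).1) (fun _ _ => rfl) henergy s.energy
  rw [Nat.add_sub_cancel, ← heq (S.τ (k + 1)) ⟨(S.τ_pos _).le, le_rfl⟩]
  exact hcopy

/-- Propagation through a range of levels with a tolerance-PRESERVING gate `Renormaliseδ δ δ`: capture at a
level `k₀ ≥ 2` implies capture at every later level, same tolerance. [cite: Tao2011, Cor. 11.4] -/
theorem CaptureAtδ.of_le {k₀ k : ℕ} {δ : ℝ} (h : CaptureAtδ k₀ δ) (hR : Renormaliseδ δ δ)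
    (hk₀ : 2 ≤ k₀) (hk : k₀ ≤ k) : CaptureAtδ k δ := by
  induction k, hk using Nat.le_induction with
  | base => exact h
  | succ k hle ih => exact ih.succ hR (hk₀.trans hle)

/-- Given a tolerance-preserving gate, `Captureδ δ` follows from its first instance `CaptureAtδ 2 δ`.
[cite: Tao2011, Cor. 11.4] -/
theorem captureδ_of_captureAtδ_two {δ : ℝ} (h₂ : CaptureAtδ 2 δ) (hR : Renormaliseδ δ δ) :
    Captureδ δ :=
  captureδ_iff_forall_captureAtδ.2 fun _ hk => h₂.of_le hR le_rfl hk

/-- **Given a tolerance-preserving gate, `Captureδ δ ↔ CaptureAtδ 2 δ`** — at every tolerance the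
∀-level alphabet-closure stub is, modulo the gate, a statement about level-`2` stages only.
[cite: Tao2011, Cor. 11.4] -/
theorem captureδ_iff_captureAtδ_two {δ : ℝ} (hR : Renormaliseδ δ δ) : Captureδ δ ↔ CaptureAtδ 2 δ :=
  ⟨fun h => h.captureAtδ le_rfl, fun h => captureδ_of_captureAtδ_two h hR⟩

/-- **Capture + the gate ⇒ heredity from level `2`, at any tolerances** (the line's composition at the
generic levels): the gate, fed the stage's own `δ`-copy clause, returns a continuation that runs and
carries the next letter, i.e. an extension stage (`Stage.exists_extends_iff_runs_letter`); the output
tolerance is not used. [folklore] -/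
theorem heredityFrom_two_of_captureδ_renormaliseδ {δ δ' : ℝ} (hC : Captureδ δ)
    (hR : Renormaliseδ δ δ') : HeredityFrom 2 := by
  intro S hP hRig hQ k hk s
  obtain ⟨u, p, hrun, hlet, -⟩ := hR S hP hRig hQ k hk s (hC S hP hRig hQ k hk s)
  exact s.exists_extends_iff_runs_letter.2 ⟨u, p, hrun, hlet⟩

/-- **Heredity from level `2` + capture at the OUTPUT tolerance ⇒ the gate**, for every input
tolerance: the extension stage's own fields run and read out a letter, and `Captureδ δout` at level
`k + 1`, applied to the extension stage, is the output copy clause. [folklore] -/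
theorem Renormaliseδ.of_heredityFrom_two {δout : ℝ} (h : HeredityFrom 2) (hC : Captureδ δout)
    (δin : ℝ) : Renormaliseδ δin δout := by
  intro S hP hR hQ k hk s _
  obtain ⟨s', hs'⟩ := h S hP hR hQ k hk s
  refine ⟨s'.u, s'.p, Runs.of_extends s s' hs', Letter.of_stage s' le_rfl, ?_⟩
  have hc := hC S hP hR hQ (k + 1) (le_trans hk (Nat.le_succ k)) s'
  rw [Nat.add_sub_cancel, (hs' (S.τ k) ⟨(S.τ_pos k).le, le_rfl⟩).1] at hc
  exact hc

/-- **Given alphabet closure at tolerance `δ`, the tolerance-preserving gate IS the child crux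
`HeredityFrom 2`.** [folklore] -/
theorem renormaliseδ_iff_heredityFrom_two {δ : ℝ} (hC : Captureδ δ) :
    Renormaliseδ δ δ ↔ HeredityFrom 2 :=
  ⟨heredityFrom_two_of_captureδ_renormaliseδ hC, fun h => Renormaliseδ.of_heredityFrom_two h hC δ⟩

/-- **The δ-UNIFORM stub set closes the crux item**: `HeredityAtOne → CaptureAtδ 2 δ → Renormaliseδ δ δ →
EpisodeInductionG` — what a re-registration of line `fc-oneshot` with BOTH stubs at one tolerance `δ`
(e.g. `δ = 1/3`) composes through (`episodeInductionG_iff_heredityAtOne_and_heredityFrom_two`, p415576).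
[folklore] -/
theorem episodeInductionG_of_heredityAtOne_captureAtδ_two_renormaliseδ {δ : ℝ} (h₁ : HeredityAtOne)
    (h₂ : CaptureAtδ 2 δ) (hR : Renormaliseδ δ δ) : EpisodeInductionG :=
  episodeInductionG_iff_heredityAtOne_and_heredityFrom_two.2
    ⟨h₁, heredityFrom_two_of_captureδ_renormaliseδ (captureδ_of_captureAtδ_two h₂ hR) hR⟩

/-- **The MIXED stub set closes the crux item**: capture tightened to any `δ ≤ 2/3`, gate kept at the
registered `2/3` — `HeredityAtOne → CaptureAtδ 2 δ → Renormalise → EpisodeInductionG` (the composition of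
the line owner's OPTION file `fc-oneshot.v24-third.OPTION.lean`, by name). [folklore] -/
theorem episodeInductionG_of_heredityAtOne_captureAtδ_two_renormalise {δ : ℝ} (h₁ : HeredityAtOne)
    (h₂ : CaptureAtδ 2 δ) (hδ : δ ≤ 2 / 3) (hR : Renormalise) : EpisodeInductionG :=
  episodeInductionG_of_heredityAtOne_captureAtTwo_renormalise h₁ (h₂.captureAt hδ) hR

/-! ## §3 The tolerance at which the copy clause is automatic -/

/-- **The copy clause is automatic at tolerance `2 c₂`.** For every stage (any viscosity, any margin),
every `j ≤ k` and every `δ ≥ 2 c₂`, the level-`k` readout `u(τ k)` is a `δ`-rescaled copy of the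
level-`j` readout `u(τ j)`: take the rigid motion `Q = 1`, anchor AND centre at the level-`k` floor point
`x₁` (`Stage.floor`), and bound the window clause by the two ceilings `‖u(τ k, ·)‖ ≤ c₂ Y_k`,
`‖u(τ j, ·)‖ ≤ c₂ Y_j` (`Stage.ceiling`) and the triangle inequality:
`‖v y - (Y_k/Y_j) • w(…)‖ ≤ c₂ Y_k + (Y_k/Y_j) c₂ Y_j = 2 c₂ Y_k`. So on a given schedule `CaptureAtδ`
has content exactly for `δ < 2 c₂` (and, by `RescaledCopy.parent_floor`, forces an active parent patch
exactly for `δ < c₁`). [folklore] -/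
theorem Stage.rescaledCopy_of_two_mul_c₂_le {ν : ℝ} {S : Schedule TowerRates.wide}
    {m : Margins TowerRates.wide} {k : ℕ} (s : Stage ν TowerRates.wide S m k) {j : ℕ} (hj : j ≤ k)
    {δ : ℝ} (hδ : 2 * S.c₂ ≤ δ) :
    RescaledCopy S j k (s.u (S.τ j)) (s.u (S.τ k)) δ := by
  obtain ⟨x₁, hx₁, hfl⟩ := s.floor k le_rfl
  have hYk : 0 < TowerRates.wide.Y k := Real.rpow_pos_of_pos (TowerRates.wide.N_pos _) _
  have hYj : 0 < TowerRates.wide.Y j := Real.rpow_pos_of_pos (TowerRates.wide.N_pos _) _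
  refine ⟨LinearIsometryEquiv.refl ℝ _, x₁, x₁, hx₁, hx₁, hfl, fun y _ => ?_⟩
  set z := x₁ + (TowerRates.wide.N k / TowerRates.wide.N j) •
    (LinearIsometryEquiv.refl ℝ (EuclideanSpace ℝ (Fin 3))).symm (y - x₁) with hz
  have hv : ‖s.u (S.τ k) y‖ ≤ S.c₂ * TowerRates.wide.Y k :=
    s.ceiling k le_rfl (S.τ k) ⟨(S.τ_pos k).le, le_rfl⟩ y
  have hw : ‖s.u (S.τ j) z‖ ≤ S.c₂ * TowerRates.wide.Y j :=
    s.ceiling j hj (S.τ j) ⟨(S.τ_pos j).le, le_rfl⟩ z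
  have hratio : 0 ≤ TowerRates.wide.Y k / TowerRates.wide.Y j := (div_pos hYk hYj).le
  calc ‖s.u (S.τ k) y - (TowerRates.wide.Y k / TowerRates.wide.Y j) •
          (LinearIsometryEquiv.refl ℝ (EuclideanSpace ℝ (Fin 3))) (s.u (S.τ j) z)‖
      ≤ ‖s.u (S.τ k) y‖ + ‖(TowerRates.wide.Y k / TowerRates.wide.Y j) •
          (LinearIsometryEquiv.refl ℝ (EuclideanSpace ℝ (Fin 3))) (s.u (S.τ j) z)‖ := norm_sub_le _ _
    _ = ‖s.u (S.τ k) y‖ + TowerRates.wide.Y k / TowerRates.wide.Y j * ‖s.u (S.τ j) z‖ := by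
        rw [norm_smul, LinearIsometryEquiv.norm_map, Real.norm_of_nonneg hratio]
    _ ≤ S.c₂ * TowerRates.wide.Y k +
          TowerRates.wide.Y k / TowerRates.wide.Y j * (S.c₂ * TowerRates.wide.Y j) :=
        add_le_add hv (mul_le_mul_of_nonneg_left hw hratio)
    _ = 2 * S.c₂ * TowerRates.wide.Y k := by
        field_simp
        ring
    _ ≤ δ * TowerRates.wide.Y k := mul_le_mul_of_nonneg_right hδ hYk.le

end Summit.NavierStokesRegularity.FluidComputer.PalasekTowerClayBridge

end
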